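import Summits.Ventures.Crystal3D.Bulk.HullSubmapEars
import Summits.Ventures.Crystal3D.Bulk.SubtendedAngles
import HarnessLib

/-!
# Face walks seen from a point: subtended-angle sum, perimeter, the inner-path rows and the
# CORNER FAN of a face (bookkeeping for the rattler prune (d1)(d2), `DESIGN-L12-THEORY` §P-L3 (d))

HONEST FRAMING. Part of the venture `Summits/Ventures/Crystal3D` (cell `pub-crystal3d`, phase 2;
seat p3), generic and configuration-free (`X` any finite set of unit vectors of `ℝ³` with `0`
interior to its hull, `σ_H = rot`, `α = inv` its hull rotation system, `Bulk/HullRotSys*.lean`);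
nothing here mentions GAP(1.26). For an `α`-closed `S ⊆ hullDarts X`, the face walk of a dart
`d` (`faceVertex S d t`, period `facePeriod S d`, `Bulk/HullFaceWalk.lean`) and a point `z`:

* `subtSum S d z = Σ_{t < period} ∠(perpTo z v_t, perpTo z v_{t+1})` — the total angle the
  sides of the face SUBTEND at `z`; `perim S d = Σ ∠(v_t, v_{t+1})` — its perimeter;
  `SidesFar S d z` — the inner-path rows (§14.3) `∠(z,v_t) + ∠(z,v_{t+1}) + ∠(v_t,v_{t+1}) ≤ perim`
  for every side;
* `dartCone X x` — the closed cone of the fan triangle on the LEFT of the hull dart `x = (y, a)`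
  (`{y, a, succV X y a}`, between `x` and `σ_H x`); **`InCornerFan S d z`** — `z` lies in one
  of the fan triangles swept by one of the CORNERS of the face of `d` (the darts
  `σ_H^i (α d_t)`, `i < retTime S (α d_t)`, at the head of the `t`-th dart `d_t`): the
  regions-free way of saying "`z` lies in the closed face";
* invariance of all four under shifting the start dart along the walk, and under passing to a
  super-map `S' ⊇ S` that does not touch the walk (`…_of_forall_phi_eq`);
* `triangle_rows_of_mem_cone` — the base case of the induction of
  `Bulk/HullFaceSubtendedEar.lean`: a unit `z ∉ {a, b, c}` in the cone of an honest triangle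
  `abc` (`orient3 a b c ≠ 0`) sees its sides under `≥ 2π` and satisfies the three inner-path rows
  (`Bulk/SubtendedAngles.lean`).

The ear induction itself and the census assembly are NOT here.
-/

noncomputable section

namespace Summit.Ventures.Crystal3D

namespace HullRotSys

open Literature.Geometry.DiscreteGeometry Finset Equiv Real InnerProductGeometry Function
open scoped InnerProductSpace

variable {X : Finset (EuclideanSpace ℝ (Fin 3))} {hX1 : ∀ y ∈ X, ‖y‖ = 1}
  {h0 : (0 : EuclideanSpace ℝ (Fin 3)) ∈ interior (convexHull ℝ (X : Set _))}

/-! ## Periodic sums -/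

/-- A sum over a full period of a periodic sequence is invariant under shifting the start. -/
theorem sum_range_shift_of_periodic (f : ℕ → ℝ) (m r : ℕ) (hf : ∀ t, f (t + m) = f t) :
    ∑ t ∈ range m, f (t + r) = ∑ t ∈ range m, f t := by
  induction r with
  | zero => simp
  | succ r ih =>
    rw [← ih]
    have h := sum_range_succ_shift (fun t => f (t + r)) m (by
      show f (0 + r) = f (m + r)
      rw [zero_add, add_comm m r, hf])
    rw [h]
    refine Finset.sum_congr rfl fun t _ => ?_
    show f (t + (r + 1)) = f (t + 1 + r)
    rw [add_assoc, add_comm r 1]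

/-! ## The walk: shifting the start dart -/

/-- Shifting the start along the walk shifts the darts. -/
theorem faceDart_shift (S : Finset ↥(hullDarts X)) (d : ↥(hullDarts X)) (r t : ℕ) :
    faceDart hX1 h0 S (faceDart hX1 h0 S d r) t = faceDart hX1 h0 S d (t + r) := by
  unfold faceDart; rw [← Perm.mul_apply, ← pow_add]

/-- The darts of the walk are periodic in the index (any multiple of the period). -/
theorem faceDart_add_mul_period (S : Finset ↥(hullDarts X)) (d : ↥(hullDarts X)) (t k : ℕ) :
    faceDart hX1 h0 S d (t + k * facePeriod hX1 h0 S d) = faceDart hX1 h0 S d t := by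
  induction k with
  | zero => rw [zero_mul, add_zero]
  | succ k ih => rw [Nat.succ_mul, ← add_assoc, faceDart_add_period, ih]

/-- The darts only depend on the index modulo the period. -/
theorem faceDart_mod (S : Finset ↥(hullDarts X)) (d : ↥(hullDarts X)) (t : ℕ) :
    faceDart hX1 h0 S d (t % facePeriod hX1 h0 S d) = faceDart hX1 h0 S d t := by
  conv_rhs => rw [← Nat.mod_add_div t (facePeriod hX1 h0 S d), mul_comm]
  rw [faceDart_add_mul_period]

/-! ## Subtended-angle sum, perimeter, inner-path rows -/

/-- **The total angle subtended at `z` by the sides of the face of `d`**: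
`Σ_{t < period} ∠(perpTo z v_t, perpTo z v_{t+1})`. -/
def subtSum (hX1 : ∀ y ∈ X, ‖y‖ = 1)
    (h0 : (0 : EuclideanSpace ℝ (Fin 3)) ∈ interior (convexHull ℝ (X : Set _)))
    (S : Finset ↥(hullDarts X)) (d : ↥(hullDarts X)) (z : EuclideanSpace ℝ (Fin 3)) : ℝ :=
  ∑ t ∈ range (facePeriod hX1 h0 S d),
    angle (perpTo z (faceVertex hX1 h0 S d t)) (perpTo z (faceVertex hX1 h0 S d (t + 1)))

/-- **The perimeter of the face walk of `d`**: `Σ_{t < period} ∠(v_t, v_{t+1})`. -/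
def perim (hX1 : ∀ y ∈ X, ‖y‖ = 1)
    (h0 : (0 : EuclideanSpace ℝ (Fin 3)) ∈ interior (convexHull ℝ (X : Set _)))
    (S : Finset ↥(hullDarts X)) (d : ↥(hullDarts X)) : ℝ :=
  ∑ t ∈ range (facePeriod hX1 h0 S d), angle (faceVertex hX1 h0 S d t) (faceVertex hX1 h0 S d (t + 1))

/-- **The inner-path rows (§14.3)** of the face of `d` at `z`: for every side `v_t v_{t+1}`,
`∠(z,v_t) + ∠(z,v_{t+1}) + ∠(v_t,v_{t+1}) ≤ perim` — the broken geodesic through `z` is at most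
the rest of the boundary. -/
def SidesFar (hX1 : ∀ y ∈ X, ‖y‖ = 1)
    (h0 : (0 : EuclideanSpace ℝ (Fin 3)) ∈ interior (convexHull ℝ (X : Set _)))
    (S : Finset ↥(hullDarts X)) (d : ↥(hullDarts X)) (z : EuclideanSpace ℝ (Fin 3)) : Prop :=
  ∀ t, t < facePeriod hX1 h0 S d →
    angle z (faceVertex hX1 h0 S d t) + angle z (faceVertex hX1 h0 S d (t + 1)) +
      angle (faceVertex hX1 h0 S d t) (faceVertex hX1 h0 S d (t + 1)) ≤ perim hX1 h0 S d

/-- The subtended sum is a property of the face: invariant under shifting the start dart. -/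
theorem subtSum_shift (S : Finset ↥(hullDarts X)) (d : ↥(hullDarts X)) (z : EuclideanSpace ℝ (Fin 3))
    (r : ℕ) : subtSum hX1 h0 S (faceDart hX1 h0 S d r) z = subtSum hX1 h0 S d z := by
  unfold subtSum
  rw [facePeriod_shift]
  simp only [faceVertex_shift]
  have := sum_range_shift_of_periodic
    (fun t => angle (perpTo z (faceVertex hX1 h0 S d t)) (perpTo z (faceVertex hX1 h0 S d (t + 1))))
    (facePeriod hX1 h0 S d) r (fun t => by
      show angle (perpTo z (faceVertex hX1 h0 S d (t + facePeriod hX1 h0 S d)))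
          (perpTo z (faceVertex hX1 h0 S d (t + facePeriod hX1 h0 S d + 1))) = _
      rw [faceVertex_add_period, show t + facePeriod hX1 h0 S d + 1 = (t + 1) + facePeriod hX1 h0 S d
        by ring, faceVertex_add_period])
  refine Eq.trans (Finset.sum_congr rfl fun t _ => ?_) this
  show _ = angle (perpTo z (faceVertex hX1 h0 S d (t + r))) (perpTo z (faceVertex hX1 h0 S d (t + r + 1)))
  rw [show t + 1 + r = t + r + 1 by ring]

/-- The perimeter is invariant under shifting the start dart. -/
theorem perim_shift (S : Finset ↥(hullDarts X)) (d : ↥(hullDarts X)) (r : ℕ) :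
    perim hX1 h0 S (faceDart hX1 h0 S d r) = perim hX1 h0 S d := by
  unfold perim
  rw [facePeriod_shift]
  simp only [faceVertex_shift]
  have := sum_range_shift_of_periodic
    (fun t => angle (faceVertex hX1 h0 S d t) (faceVertex hX1 h0 S d (t + 1)))
    (facePeriod hX1 h0 S d) r (fun t => by
      show angle (faceVertex hX1 h0 S d (t + facePeriod hX1 h0 S d))
          (faceVertex hX1 h0 S d (t + facePeriod hX1 h0 S d + 1)) = _
      rw [faceVertex_add_period, show t + facePeriod hX1 h0 S d + 1 = (t + 1) + facePeriod hX1 h0 S d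
        by ring, faceVertex_add_period])
  refine Eq.trans (Finset.sum_congr rfl fun t _ => ?_) this
  show _ = angle (faceVertex hX1 h0 S d (t + r)) (faceVertex hX1 h0 S d (t + r + 1))
  rw [show t + 1 + r = t + r + 1 by ring]

/-- The inner-path rows transfer along the walk (forward). -/
theorem SidesFar.of_shift {S : Finset ↥(hullDarts X)} {d : ↥(hullDarts X)} {z : EuclideanSpace ℝ (Fin 3)}
    (r : ℕ) (h : SidesFar hX1 h0 S (faceDart hX1 h0 S d r) z) : SidesFar hX1 h0 S d z := by
  intro t ht
  set m := facePeriod hX1 h0 S d with hm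
  have hpos : 0 < m := facePeriod_pos S d
  -- the side `t` of `d` is the side `t + (m·r − r)` of the shifted walk, reduced mod `m`
  have h' := h ((t + (m * r - r)) % m) (by rw [facePeriod_shift]; exact Nat.mod_lt _ hpos)
  rw [perim_shift, faceVertex_shift, faceVertex_shift] at h'
  have hle : r ≤ m * r := Nat.le_mul_of_pos_left r hpos
  have e1 : faceVertex hX1 h0 S d ((t + (m * r - r)) % m + r) = faceVertex hX1 h0 S d t := by
    rw [← faceVertex_mod S d (_ + r), ← hm, Nat.add_mod, Nat.mod_mod, ← Nat.add_mod,
      show t + (m * r - r) + r = t + r * m by rw [add_assoc, Nat.sub_add_cancel hle]; ring,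
      Nat.add_mul_mod_self_right, hm, faceVertex_mod]
  have e2 : faceVertex hX1 h0 S d ((t + (m * r - r)) % m + 1 + r) = faceVertex hX1 h0 S d (t + 1) := by
    rw [← faceVertex_mod S d (_ + 1 + r), ← hm, add_assoc, Nat.add_mod, Nat.mod_mod, ← Nat.add_mod,
      show t + (m * r - r) + (1 + r) = (t + 1) + r * m by
        rw [show t + (m * r - r) + (1 + r) = t + 1 + ((m * r - r) + r) by ring, Nat.sub_add_cancel hle]; ring,
      Nat.add_mul_mod_self_right, hm, faceVertex_mod]
  rw [e1, e2] at h'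
  exact h'

/-! ## The corner fan of a face -/

/-- **The closed cone of the fan triangle on the left of the dart `x = (y, a)`** — the triangle
`{y, a, succV X y a}` between `x` and `σ_H x`. -/
def dartCone (X : Finset (EuclideanSpace ℝ (Fin 3))) (x : ↥(hullDarts X)) :
    Set (EuclideanSpace ℝ (Fin 3)) :=
  {w | ∃ a b c : ℝ, 0 ≤ a ∧ 0 ≤ b ∧ 0 ≤ c ∧ w = a • x.1.1 + b • x.1.2 + c • succV X x.1.1 x.1.2}

/-- **`z` lies in the corner fan of the face of `d`**: for some dart `d_t` of the walk and some
`i < retTime S (α d_t)`, `z` is in the cone of the fan triangle on the left of `σ_H^i (α d_t)` —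
one of the triangles swept by the corner of the face at the head of `d_t`. -/
def InCornerFan (hX1 : ∀ y ∈ X, ‖y‖ = 1)
    (h0 : (0 : EuclideanSpace ℝ (Fin 3)) ∈ interior (convexHull ℝ (X : Set _)))
    (S : Finset ↥(hullDarts X)) (d : ↥(hullDarts X)) (z : EuclideanSpace ℝ (Fin 3)) : Prop :=
  ∃ t i : ℕ, i < RotSys.retTime (rot hX1 h0) S (inv X (faceDart hX1 h0 S d t)) ∧
    z ∈ dartCone X ((rot hX1 h0 ^ i) (inv X (faceDart hX1 h0 S d t)))

/-- The corner fan is a property of the face (forward shift). -/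
theorem InCornerFan.of_shift {S : Finset ↥(hullDarts X)} {d : ↥(hullDarts X)}
    {z : EuclideanSpace ℝ (Fin 3)} (r : ℕ) (h : InCornerFan hX1 h0 S (faceDart hX1 h0 S d r) z) :
    InCornerFan hX1 h0 S d z := by
  obtain ⟨t, i, hi, hz⟩ := h
  rw [faceDart_shift] at hi hz
  exact ⟨t + r, i, hi, hz⟩

/-- The corner fan is a property of the face (backward shift). -/
theorem InCornerFan.shift {S : Finset ↥(hullDarts X)} {d : ↥(hullDarts X)}
    {z : EuclideanSpace ℝ (Fin 3)} (h : InCornerFan hX1 h0 S d z) (r : ℕ) :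
    InCornerFan hX1 h0 S (faceDart hX1 h0 S d r) z := by
  obtain ⟨t, i, hi, hz⟩ := h
  set m := facePeriod hX1 h0 S d with hm
  have hpos : 0 < m := facePeriod_pos S d
  have hle : r ≤ m * r := Nat.le_mul_of_pos_left r hpos
  have e : faceDart hX1 h0 S (faceDart hX1 h0 S d r) (t + (m * r - r)) = faceDart hX1 h0 S d t := by
    rw [faceDart_shift, show t + (m * r - r) + r = t + r * m by
      rw [add_assoc, Nat.sub_add_cancel hle]; ring, hm, faceDart_add_mul_period]
  exact ⟨t + (m * r - r), i, by rw [e]; exact hi, by rw [e]; exact hz⟩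

/-! ## A super-map that does not touch the walk -/

/-- If the face permutations of `S` and `S'` agree along the whole walk of `d` in `S`, the darts
of the two walks agree. -/
theorem faceDart_eq_of_forall_phi_eq {S S' : Finset ↥(hullDarts X)} {d : ↥(hullDarts X)}
    (heq : ∀ t, RotSys.phi (rot hX1 h0) (inv X) S' (faceDart hX1 h0 S d t) =
      RotSys.phi (rot hX1 h0) (inv X) S (faceDart hX1 h0 S d t)) (t : ℕ) :
    faceDart hX1 h0 S' d t = faceDart hX1 h0 S d t := by
  induction t with
  | zero => rw [faceDart_zero, faceDart_zero]
  | succ t ih => rw [faceDart_succ, faceDart_succ, ih, heq]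

/-- … and so do the periods. -/
theorem facePeriod_eq_of_forall_phi_eq {S S' : Finset ↥(hullDarts X)} {d : ↥(hullDarts X)}
    (heq : ∀ t, RotSys.phi (rot hX1 h0) (inv X) S' (faceDart hX1 h0 S d t) =
      RotSys.phi (rot hX1 h0) (inv X) S (faceDart hX1 h0 S d t)) :
    facePeriod hX1 h0 S' d = facePeriod hX1 h0 S d := by
  have hdart := faceDart_eq_of_forall_phi_eq (hX1 := hX1) (h0 := h0) heq
  unfold facePeriod
  refine RotSys.minimalPeriod_eq_of_first_return _ d (facePeriod_pos S d) ?_ ?_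
  · have := hdart (facePeriod hX1 h0 S d)
    unfold faceDart facePeriod at this
    rw [this]
    exact RotSys.pow_minimalPeriod_apply _ d
  · intro k hk0 hk heqk
    have h1 := hdart k
    unfold faceDart at h1
    rw [h1] at heqk
    have := RotSys.pow_apply_injOn _ d (i := k) (j := 0) hk (facePeriod_pos S d)
      (by rw [pow_zero, Perm.one_apply]; exact heqk)
    omega

/-- … and the vertices. -/
theorem faceVertex_eq_of_forall_phi_eq {S S' : Finset ↥(hullDarts X)} {d : ↥(hullDarts X)}
    (heq : ∀ t, RotSys.phi (rot hX1 h0) (inv X) S' (faceDart hX1 h0 S d t) =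
      RotSys.phi (rot hX1 h0) (inv X) S (faceDart hX1 h0 S d t)) (t : ℕ) :
    faceVertex hX1 h0 S' d t = faceVertex hX1 h0 S d t := by
  unfold faceVertex; rw [faceDart_eq_of_forall_phi_eq heq]

/-- Untouched walk: same subtended sum. -/
theorem subtSum_eq_of_forall_phi_eq {S S' : Finset ↥(hullDarts X)} {d : ↥(hullDarts X)}
    (heq : ∀ t, RotSys.phi (rot hX1 h0) (inv X) S' (faceDart hX1 h0 S d t) =
      RotSys.phi (rot hX1 h0) (inv X) S (faceDart hX1 h0 S d t)) (z : EuclideanSpace ℝ (Fin 3)) :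
    subtSum hX1 h0 S' d z = subtSum hX1 h0 S d z := by
  unfold subtSum
  rw [facePeriod_eq_of_forall_phi_eq heq]
  simp only [faceVertex_eq_of_forall_phi_eq heq]

/-- Untouched walk: same perimeter. -/
theorem perim_eq_of_forall_phi_eq {S S' : Finset ↥(hullDarts X)} {d : ↥(hullDarts X)}
    (heq : ∀ t, RotSys.phi (rot hX1 h0) (inv X) S' (faceDart hX1 h0 S d t) =
      RotSys.phi (rot hX1 h0) (inv X) S (faceDart hX1 h0 S d t)) :
    perim hX1 h0 S' d = perim hX1 h0 S d := by
  unfold perim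
  rw [facePeriod_eq_of_forall_phi_eq heq]
  simp only [faceVertex_eq_of_forall_phi_eq heq]

/-- Untouched walk: the inner-path rows transfer back. -/
theorem sidesFar_of_forall_phi_eq {S S' : Finset ↥(hullDarts X)} {d : ↥(hullDarts X)}
    (heq : ∀ t, RotSys.phi (rot hX1 h0) (inv X) S' (faceDart hX1 h0 S d t) =
      RotSys.phi (rot hX1 h0) (inv X) S (faceDart hX1 h0 S d t)) {z : EuclideanSpace ℝ (Fin 3)}
    (h : SidesFar hX1 h0 S' d z) : SidesFar hX1 h0 S d z := by
  intro t ht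
  have := h t (by rw [facePeriod_eq_of_forall_phi_eq heq]; exact ht)
  rwa [perim_eq_of_forall_phi_eq heq, faceVertex_eq_of_forall_phi_eq heq,
    faceVertex_eq_of_forall_phi_eq heq] at this

/-- Untouched walk inside a SUPER-map `S ⊆ S'`: the corner fan passes to `S'` (the corners of the
face are the same, because the `S'`-successor of each reversed walk dart is still in `S`). -/
theorem inCornerFan_of_forall_phi_eq {S S' : Finset ↥(hullDarts X)} (hsub : S ⊆ S')
    (hS : RotSys.IsClosed (inv X) S) {d : ↥(hullDarts X)} (hd : d ∈ S)
    (heq : ∀ t, RotSys.phi (rot hX1 h0) (inv X) S' (faceDart hX1 h0 S d t) =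
      RotSys.phi (rot hX1 h0) (inv X) S (faceDart hX1 h0 S d t)) {z : EuclideanSpace ℝ (Fin 3)}
    (h : InCornerFan hX1 h0 S d z) : InCornerFan hX1 h0 S' d z := by
  obtain ⟨t, i, hi, hz⟩ := h
  refine ⟨t, i, ?_, ?_⟩
  · rw [faceDart_eq_of_forall_phi_eq heq]
    have hx : inv X (faceDart hX1 h0 S d t) ∈ S := hS _ (faceDart_mem hS hd t)
    have hmem : RotSys.induce (rot hX1 h0) S' (inv X (faceDart hX1 h0 S d t)) ∈ S := by
      rw [← RotSys.phi_apply, heq t, RotSys.phi_apply]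
      exact RotSys.induce_apply_mem _ hx
    rw [← RotSys.retTime_subset_of_mem (rot hX1 h0) hsub hx hmem]
    exact hi
  · rw [faceDart_eq_of_forall_phi_eq heq]; exact hz

/-! ## The base case: a point in the cone of an honest triangle -/

/-- A nonnegative combination of the vertices of a triangle that reproduces a unit vector `z`
annihilates the tangential projections at `z`. -/
theorem perpTo_combination_eq_zero {z a b c : EuclideanSpace ℝ (Fin 3)} (hz : ‖z‖ = 1)
    {α β γ : ℝ} (h : z = α • a + β • b + γ • c) :
    α • perpTo z a + β • perpTo z b + γ • perpTo z c = 0 := by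
  have hzz : ⟪z, z⟫_ℝ = 1 := by rw [real_inner_self_eq_norm_sq, hz, one_pow]
  simp only [perpTo_of_norm_eq_one hz, smul_sub, smul_smul]
  have hcomb : α * ⟪z, a⟫_ℝ + β * ⟪z, b⟫_ℝ + γ * ⟪z, c⟫_ℝ = 1 := by
    have : ⟪z, z⟫_ℝ = ⟪z, α • a + β • b + γ • c⟫_ℝ := by rw [← h]
    rw [hzz, inner_add_right, inner_add_right, real_inner_smul_right, real_inner_smul_right,
      real_inner_smul_right] at this
    linarith
  calc α • a - (α * ⟪z, a⟫_ℝ) • z + (β • b - (β * ⟪z, b⟫_ℝ) • z) + (γ • c - (γ * ⟪z, c⟫_ℝ) • z)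
      = (α • a + β • b + γ • c) - (α * ⟪z, a⟫_ℝ + β * ⟪z, b⟫_ℝ + γ * ⟪z, c⟫_ℝ) • z := by
        rw [add_smul, add_smul]; abel
    _ = 0 := by rw [← h, hcomb, one_smul, sub_self]

/-- For unit vectors `z ≠ ±a`, the projection `perpTo z a` is nonzero. -/
theorem perpTo_ne_zero_of_ne {z a : EuclideanSpace ℝ (Fin 3)} (hz : ‖z‖ = 1) (ha : ‖a‖ = 1)
    (h1 : a ≠ z) (h2 : a ≠ -z) : perpTo z a ≠ 0 := by
  intro h
  have hsq := norm_perpTo_sq_of_norm_eq_one hz ha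
  rw [h, norm_zero, sq, zero_mul] at hsq
  have : ⟪z, a⟫_ℝ ^ 2 = 1 := by linarith
  have hprod : (⟪z, a⟫_ℝ - 1) * (⟪z, a⟫_ℝ + 1) = 0 := by linear_combination this
  rcases mul_eq_zero.1 hprod with h' | h'
  · exact h1 ((inner_eq_one_iff_of_norm_eq_one hz ha).1 (sub_eq_zero.1 h')).symm
  · have h'' : ⟪a, z⟫_ℝ = -1 := by rw [real_inner_comm]; linarith
    exact h2 ((inner_eq_neg_one_iff_of_norm_eq_one ha hz).1 h'')

/-- In an honest triangle (`orient3 a b c ≠ 0`) no vertex is ANTIPODAL to a point of its closed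
cone. -/
theorem ne_neg_of_mem_cone {z a b c : EuclideanSpace ℝ (Fin 3)} (habc : orient3 a b c ≠ 0)
    {α β γ : ℝ} (hα : 0 ≤ α) (hβ : 0 ≤ β) (hγ : 0 ≤ γ) (h : z = α • a + β • b + γ • c) :
    a ≠ -z ∧ b ≠ -z ∧ c ≠ -z := by
  refine ⟨fun ha => habc ?_, fun hb => habc ?_, fun hc => habc ?_⟩
  · have e : (α + 1) • a + β • b + γ • c = 0 := by
      calc (α + 1) • a + β • b + γ • c = (α • a + β • b + γ • c) + a := by
            rw [add_smul, one_smul]; abel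
        _ = 0 := by rw [← h, ha, add_neg_cancel]
    have := congrArg (fun w => orient3 w b c) e
    simp only [orient3_add_left, orient3_smul_left, orient3_self_left, orient3_self_outer,
      orient3_zero_left, mul_zero, add_zero] at this
    exact (mul_eq_zero.1 this).resolve_left (by linarith)
  · have e : α • a + (β + 1) • b + γ • c = 0 := by
      calc α • a + (β + 1) • b + γ • c = (α • a + β • b + γ • c) + b := by
            rw [add_smul, one_smul]; abel
        _ = 0 := by rw [← h, hb, add_neg_cancel]
    have := congrArg (fun w => orient3 a w c) e
    simp only [orient3_add_mid, orient3_smul_mid, orient3_self_left, orient3_self_right,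
      orient3_zero_mid, mul_zero, add_zero, zero_add] at this
    exact (mul_eq_zero.1 this).resolve_left (by linarith)
  · have e : α • a + β • b + (γ + 1) • c = 0 := by
      calc α • a + β • b + (γ + 1) • c = (α • a + β • b + γ • c) + c := by
            rw [add_smul, one_smul]; abel
        _ = 0 := by rw [← h, hc, add_neg_cancel]
    have := congrArg (fun w => orient3 a b w) e
    simp only [orient3_add_right, orient3_smul_right, orient3_self_right, orient3_self_outer,
      orient3_zero_right, mul_zero, add_zero, zero_add] at this
    exact (mul_eq_zero.1 this).resolve_left (by linarith)

/-- **The triangle rows.** A unit vector `z`, distinct from the unit vertices `a, b, c` of an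
honest triangle (`orient3 a b c ≠ 0`) and lying in its closed cone, sees the three sides under a
total angle `≥ 2π` (winding) and satisfies the three inner-path rows. -/
theorem triangle_rows_of_mem_cone {z a b c : EuclideanSpace ℝ (Fin 3)} (hz : ‖z‖ = 1)
    (ha : ‖a‖ = 1) (hb : ‖b‖ = 1) (hc : ‖c‖ = 1) (hza : a ≠ z) (hzb : b ≠ z) (hzc : c ≠ z)
    (habc : orient3 a b c ≠ 0) {α β γ : ℝ} (hα : 0 ≤ α) (hβ : 0 ≤ β) (hγ : 0 ≤ γ)
    (h : z = α • a + β • b + γ • c) :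
    2 * π ≤ angle (perpTo z a) (perpTo z b) + angle (perpTo z b) (perpTo z c) +
        angle (perpTo z c) (perpTo z a) ∧
      angle z a + angle z b ≤ angle c a + angle c b ∧
      angle z b + angle z c ≤ angle a b + angle a c ∧
      angle z c + angle z a ≤ angle b c + angle b a := by
  have hz0 : z ≠ 0 := by intro h0; rw [h0, norm_zero] at hz; exact zero_ne_one hz
  obtain ⟨hna, hnb, hnc⟩ := ne_neg_of_mem_cone habc hα hβ hγ h
  have hpa := perpTo_ne_zero_of_ne hz ha hza hna
  have hpb := perpTo_ne_zero_of_ne hz hb hzb hnb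
  have hpc := perpTo_ne_zero_of_ne hz hc hzc hnc
  have hsum : 0 < α + β + γ := by
    by_contra hle
    have ha0 : α = 0 := by linarith
    have hb0 : β = 0 := by linarith
    have hc0 : γ = 0 := by linarith
    rw [ha0, hb0, hc0, zero_smul, zero_smul, zero_smul, add_zero, add_zero] at h
    exact hz0 h
  refine ⟨two_pi_le_angle_add_angle_add_angle hpa hpb hpc hα hβ hγ hsum
      (perpTo_combination_eq_zero hz h),
    angle_add_angle_le_of_mem_cone3 hz0 hα hβ hγ h,
    angle_add_angle_le_of_mem_cone3 hz0 hβ hγ hα (by rw [h]; abel),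
    angle_add_angle_le_of_mem_cone3 hz0 hγ hα hβ (by rw [h]; abel)⟩

end HullRotSys

end Summit.Ventures.Crystal3D
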